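import Summits.Ventures.WeilGRH.DualTrigKernelLatticeFastDefs
import Summits.Ventures.WeilGRH.DualTrigKernelLatticeCells
import Summits.Ventures.WeilGRH.DualTrigKernelLatticeSoundB
import HarnessLib

/-!
# Format D-K v3.2 (multi-lattice): soundness of the fast cell checker, part 1 — the fast moments

Cell `rh-explicit`, WEIL TRACK — GRH ARM, route B (weil-grh-3).  For the definitions see
`DualTrigKernelLatticeFastDefs.lean`.  Here: the O(R) update `addTermI` (`getD_addTermI`), the base-term pass
`momentsB_mem` (= `moments3_mem` with `addTermF`), the shared lattice phase (`mem_mcPow`, `latMomAux_mem`), the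
integer-power moments and their scaling (`imoment`, `IMomMem`, `imomMem_addTermK`, `moment_latAtomsR_eq`,
`momMem_scaleMom`), `latMom_mem` / `latsMom_mem`, `ncList_append` / `ncList_latJoin`, and **`momentsP_mem`**: the fast
accumulators enclose the real moments of `terms3R` (all terms, and the non-periodic ones) at the cell centre.
Everything here is PROVED; no named facts, no `sorry`, no kernel evaluation.
-/

noncomputable section

open Finset Real Complex

namespace Summit.Ventures.WeilGRH

open Literature.Analysis.ValidatedNumerics.NumericsMP
open Literature.NumberTheory.LFunctions
open DualTrigTaylor DigammaVertical

namespace DKCert3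

variable {c : DKCert3}

/-! ### Soundness of the fast moments -/

variable {c : DKCert3}

/-- `mcPow` encloses `z^n`. [folklore] -/
theorem mem_mcPow {S : ℕ} (hS : 0 < S) {z : ℂ} {Z : MC} (hz : MC.mem S z Z) :
    ∀ n : ℕ, MC.mem S (z ^ n) (mcPow S Z n)
  | 0 => by simpa [mcPow] using MC.mem_ofInt S 1
  | n + 1 => by rw [pow_succ]; exact MC.mem_mul hS (mem_mcPow hS hz n) hz

/-- The integer-power moments of a list of atoms of lattice `l` at the centre `θc`:
`Σ_atoms W_m(θc) · k^m`. [folklore] -/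
def imoment (c : DKCert3) (l : DKLat) (atoms : List DKAtom) (θc : ℝ) (m : ℕ) : ℝ :=
  (atoms.map fun atm ↦ (c.latAtomR l atm).W θc m * (atm.k : ℝ) ^ m).sum

/-- [folklore] -/
@[simp] theorem imoment_nil (l : DKLat) (θc : ℝ) (m : ℕ) : c.imoment l [] θc m = 0 := by simp [imoment]

/-- [folklore] -/
@[simp] theorem imoment_cons (l : DKLat) (atm : DKAtom) (atoms : List DKAtom) (θc : ℝ) (m : ℕ) :
    c.imoment l (atm :: atoms) θc m = (c.latAtomR l atm).W θc m * (atm.k : ℝ) ^ m + c.imoment l atoms θc m := by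
  simp [imoment]

/-- The moments of the lattice atoms are the scaled integer-power moments: `moment = r_p^m · imoment`.
[folklore] -/
theorem moment_latAtomsR_eq (l : DKLat) (θc : ℝ) (m : ℕ) : ∀ (atoms : List DKAtom),
    moment (atoms.map (c.latAtomR l)) θc m = c.imoment l atoms θc m * c.ratR l ^ m
  | [] => by simp
  | atm :: atoms => by
      rw [List.map_cons, moment_cons, imoment_cons, moment_latAtomsR_eq l θc m atoms]
      have hk : (c.latAtomR l atm).κ = atm.k * c.ratR l := rfl
      rw [hk, mul_pow]; ring

/-- `addTermI` keeps the length. [folklore] -/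
theorem length_addTermI (U V : MI) (k : ℤ) : ∀ (xs : List MI) (m : ℕ) (km : ℤ),
    (addTermI U V k m km xs).length = xs.length
  | [], _, _ => rfl
  | x :: xs, m, km => by simp [addTermI, length_addTermI U V k xs (m + 1) (km * k)]

/-- What `addTermI` computes: entry `i` becomes `xs[i] + W_{m+i} · k^{m+i}`. [folklore] -/
theorem getD_addTermI {S : ℕ} {U V : MI} {w : ℕ → ℝ} (hW : ∀ m, MI.mem S (w m) (if m % 2 = 0 then U else V)) (k : ℤ) :
    ∀ (xs : List MI) (m i : ℕ), i < xs.length → ∀ {x : ℝ}, MI.mem S x (xs.getD i DKCert.dft) →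
      MI.mem S (x + w (m + i) * (k : ℝ) ^ (m + i)) ((addTermI U V k m (k ^ m) xs).getD i DKCert.dft)
  | [], _, _, hi, _, _ => by simp at hi
  | x :: xs, m, 0, _, y, hy => by
      simp only [addTermI, List.getD_cons_zero, add_zero] at hy ⊢
      have := MI.mem_mulInt (hW m) (k ^ m)
      push_cast at this
      exact MI.mem_add hy this
  | x :: xs, m, i + 1, hi, y, hy => by
      simp only [addTermI, List.getD_cons_succ] at hy ⊢
      have e : k ^ m * k = k ^ (m + 1) := by ring
      rw [e, show m + (i + 1) = (m + 1) + i by ring]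
      exact getD_addTermI hW k xs (m + 1) i (by simpa using hi) hy

/-- `zeroMom` has `2R` entries. [folklore] -/
theorem length_zeroMom : c.base.zeroMom.length = 2 * c.base.R := by simp [DKCert.zeroMom]

/-- `DKCert.addTerm` produces `2R` entries. [folklore] -/
theorem length_addTerm (t : DKCert.GTerm) (U V : MI) (mom : List MI) : (c.base.addTerm t U V mom).length = 2 * c.base.R := by
  simp [DKCert.addTerm]

/-- A list of `2R` intervals encloses the integer-power moments `m < 2R`. [folklore] -/
def IMomMem (c : DKCert3) (l : DKLat) (atoms : List DKAtom) (θc : ℝ) (mom : List MI) : Prop :=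
  mom.length = 2 * c.base.R ∧ ∀ m < 2 * c.base.R, MI.mem c.base.S (c.imoment l atoms θc m) (mom.getD m DKCert.dft)

/-- `zeroMom` encloses the integer-power moments of no atoms. [folklore] -/
theorem imomMem_zero (l : DKLat) (θc : ℝ) : c.IMomMem l [] θc c.base.zeroMom := by
  refine ⟨length_zeroMom, fun m hm ↦ ?_⟩
  simp only [imoment_nil, DKCert.zeroMom, List.getD_eq_getElem?_getD, List.getElem?_map, List.getElem?_range hm,
    Option.map_some, Option.getD_some]
  simpa using MI.mem_ofInt c.base.S 0

/-- `addTermK` adds the integer-power moments of one atom. [folklore] -/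
theorem imomMem_addTermK {l : DKLat} {atm : DKAtom} {θc : ℝ} {U V : MI}
    (hU : MI.mem c.base.S ((c.latAtomR l atm).U θc) U) (hV : MI.mem c.base.S ((c.latAtomR l atm).V θc) V)
    {atoms : List DKAtom} {mom : List MI} (hmom : c.IMomMem l atoms θc mom) :
    c.IMomMem l (atm :: atoms) θc (addTermK U V atm.k mom) := by
  have hW : ∀ m, MI.mem c.base.S ((c.latAtomR l atm).W θc m) (if m % 2 = 0 then U else V) := by
    intro m; unfold RTerm.W; split_ifs <;> assumption
  refine ⟨by unfold addTermK; rw [length_addTermI, hmom.1], fun m hm ↦ ?_⟩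
  have h := getD_addTermI hW (atm.k : ℤ) mom 0 m (by rw [hmom.1]; exact hm) (hmom.2 m hm)
  simp only [zero_add, pow_zero, Int.cast_natCast] at h
  unfold addTermK
  rw [imoment_cons, add_comm]
  simpa using h

/-- A pair (length `2R`, moments enclosed). [folklore] -/
def MomMemL (c : DKCert3) (rts : List RTerm) (θc : ℝ) (mom : List MI) : Prop :=
  mom.length = 2 * c.base.R ∧ DKCert.MomMem c.base rts θc mom

/-- `addTermF` adds the moments of one represented base term. [folklore] -/
theorem momMemL_addTermF (hS : 0 < c.base.S) {t : DKCert.GTerm} {rt : RTerm} (h : DKCert.GRepr c.base.S c.base.R t rt)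
    {θc : ℝ} {U V : MI} (hU : MI.mem c.base.S (rt.U θc) U) (hV : MI.mem c.base.S (rt.V θc) V)
    {rts : List RTerm} {mom : List MI} (hmom : c.MomMemL rts θc mom) :
    c.MomMemL (rt :: rts) θc (c.addTermF t U V mom) := by
  unfold addTermF
  by_cases hi : t.isInt = true
  · rw [if_pos hi]
    have hW : ∀ m, MI.mem c.base.S (rt.W θc m) (if m % 2 = 0 then U else V) := by
      intro m; unfold RTerm.W; split_ifs <;> assumption
    refine ⟨by rw [length_addTermI, hmom.1], fun m hm ↦ ?_⟩
    have hx := hmom.2 m hm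
    have h2 := getD_addTermI hW (t.k : ℤ) mom 0 m (by rw [hmom.1]; exact hm) hx
    simp only [zero_add, pow_zero, Int.cast_natCast] at h2
    rw [moment_cons, h.intK hi, add_comm]
    simpa using h2
  · rw [if_neg hi]
    exact ⟨length_addTerm t U V mom, DKCert.momMem_addTerm hS h hU hV hmom.2⟩

/-- **The accumulators of `momentsB` enclose the real moments** (all terms, and the non-periodic ones) — the
proof of `moments3_mem` with `momMemL_addTermF`. [folklore] -/
theorem momentsB_mem (hS : 0 < c.base.S) (hpi : MI.mem c.base.S Real.pi c.base.piI) {b : DKBlock}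
    (htab : c.base.tabOK b = true) (hMc : 1 ≤ b.Mc) (j : ℤ) :
    ∀ {ts : List DKCert.GTerm} {rts : List RTerm}, List.Forall₂ (DKCert.GRepr c.base.S c.base.R) ts rts →
      ∀ {acc : List MI × List MI}, c.momentsB b j ts = some acc →
        c.MomMemL rts ((2 * j + 1) * π / b.Mc) acc.1 ∧
          c.MomMemL (DKCert.ncList ts rts) ((2 * j + 1) * π / b.Mc) acc.2 := by
  intro ts rts hF
  induction hF with
  | nil =>
      intro acc hacc
      simp only [momentsB, Option.some.injEq] at hacc
      subst hacc
      refine ⟨⟨length_zeroMom, DKCert.momMem_zero _⟩, ?_⟩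
      have e : DKCert.ncList ([] : List DKCert.GTerm) ([] : List RTerm) = [] := rfl
      rw [e]; exact ⟨length_zeroMom, DKCert.momMem_zero _⟩
  | @cons t rt ts rts hh hF ih =>
      intro acc hacc
      cases hrec : c.momentsB b j ts with
      | none => simp [momentsB, hrec] at hacc
      | some acc' =>
        obtain ⟨accA, accN⟩ := acc'
        obtain ⟨ihA, ihN⟩ := ih hrec
        cases hZ : c.phase3 b j t with
        | none => simp [momentsB, hrec, hZ] at hacc
        | some Z =>
          simp only [momentsB, hrec, hZ, Option.some.injEq] at hacc
          subst hacc
          obtain ⟨hc, hs⟩ := mem_phase3 hS hpi htab hMc hh j hZ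
          obtain ⟨hU, hV⟩ := DKCert.mem_rotUV hS hh hc hs
          refine ⟨momMemL_addTermF hS hh hU hV ihA, ?_⟩
          by_cases hcomm : t.comm = true
          · simpa [DKCert.ncList, hcomm] using ihN
          · simpa [DKCert.ncList, hcomm] using momMemL_addTermF hS hh hU hV ihN

/-- `latMomAux` encloses the integer-power moments, given the unit phase `Z ∋ e^{i r_p θ_c}` and the running
phase `Zc ∋ e^{i kc r_p θ_c}`. [folklore] -/
theorem latMomAux_mem (hS : 0 < c.base.S) {l : DKLat} (hr : MI.mem c.base.S (c.ratR l) l.rI) {θc : ℝ} {Z : MC}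
    (hZ : MC.mem c.base.S (Complex.exp (↑(c.ratR l * θc) * I)) Z) :
    ∀ (atoms : List DKAtom) (kc : ℕ) (Zc : MC), MC.mem c.base.S (Complex.exp (↑(c.ratR l * θc) * I) ^ kc) Zc →
      c.IMomMem l atoms θc (c.latMomAux l Z kc Zc atoms)
  | [], kc, Zc, _ => by simpa [latMomAux] using imomMem_zero (c := c) l θc
  | atm :: atoms, kc, Zc, hZc => by
      simp only [latMomAux]
      set Zk := (if kc ≤ atm.k then MC.mul c.base.S Zc (mcPow c.base.S Z (atm.k - kc))
        else mcPow c.base.S Z atm.k) with hZk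
      have hZkm : MC.mem c.base.S (Complex.exp (↑(c.ratR l * θc) * I) ^ atm.k) Zk := by
        by_cases hle : kc ≤ atm.k
        · rw [hZk, if_pos hle]
          have := MC.mem_mul hS hZc (mem_mcPow hS hZ (atm.k - kc))
          rw [← pow_add, Nat.add_sub_cancel' hle] at this
          exact this
        · rw [hZk, if_neg hle]; exact mem_mcPow hS hZ atm.k
      have hph : Complex.exp (↑(c.ratR l * θc) * I) ^ atm.k =
          Complex.exp (↑((c.latAtomR l atm).κ * θc) * I) := by
        rw [← Complex.exp_nat_mul]
        congr 1
        have hk : (c.latAtomR l atm).κ = atm.k * c.ratR l := rfl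
        rw [hk]; push_cast; ring
      rw [hph] at hZkm
      have hcos := hZkm.1
      have hsin := hZkm.2
      rw [Complex.exp_ofReal_mul_I_re] at hcos
      rw [Complex.exp_ofReal_mul_I_im] at hsin
      obtain ⟨hU, hV⟩ := DKCert.mem_rotUV hS (latAtomTerm_repr hS hr atm) hcos hsin
      rw [← hph] at hZkm
      exact imomMem_addTermK hU hV (latMomAux_mem hS hr hZ atoms atm.k Zk hZkm)

/-- `scaleMom` turns integer-power moments into the moments of the lattice atoms. [folklore] -/
theorem momMem_scaleMom (hS : 0 < c.base.S) {l : DKLat} {atoms : List DKAtom} {θc : ℝ} {mom rp : List MI}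
    (hmom : c.IMomMem l atoms θc mom) (hrp : ∀ m ≤ 2 * c.base.R + 1, MI.mem c.base.S (c.ratR l ^ m) (rp.getD m DKCert.dft)) :
    DKCert.MomMem c.base (atoms.map (c.latAtomR l)) θc (c.scaleMom rp mom) := by
  intro m hm
  simp only [scaleMom, List.getD_eq_getElem?_getD, List.getElem?_map, List.getElem?_range hm,
    Option.map_some, Option.getD_some, moment_latAtomsR_eq]
  have h1 := hmom.2 m hm
  have h2 := hrp m (by omega)
  rw [List.getD_eq_getElem?_getD] at h1 h2
  exact MI.mem_mul hS h1 h2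

/-- Moments are additive in the term list. [folklore] -/
theorem moment_append (xs ys : List RTerm) (θc : ℝ) (m : ℕ) :
    moment (xs ++ ys) θc m = moment xs θc m + moment ys θc m := by
  simp [moment, List.map_append, List.sum_append]

/-- `addMom` encloses the moments of a concatenation. [folklore] -/
theorem momMem_addMom {xs ys : List RTerm} {θc : ℝ} {m1 m2 : List MI} (h1 : DKCert.MomMem c.base xs θc m1)
    (h2 : DKCert.MomMem c.base ys θc m2) : DKCert.MomMem c.base (xs ++ ys) θc (c.addMom m1 m2) := by
  intro m hm
  simp only [addMom, List.getD_eq_getElem?_getD, List.getElem?_map, List.getElem?_range hm,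
    Option.map_some, Option.getD_some, moment_append]
  have e1 := h1 m hm
  have e2 := h2 m hm
  rw [List.getD_eq_getElem?_getD] at e1 e2
  exact MI.mem_add e1 e2

/-- **`latMom` encloses the moments of the atoms of lattice `l`** at `θc = (2j+1)π/Mc`. [folklore] -/
theorem latMom_mem (hS : 0 < c.base.S) (hpi : MI.mem c.base.S Real.pi c.base.piI) {b : DKBlock} (hMc : 1 ≤ b.Mc)
    {l : DKLat} (hr : MI.mem c.base.S (c.ratR l) l.rI) (j : ℤ) {mom : List MI} (h : c.latMom b j l = some mom) :
    DKCert.MomMem c.base (c.latAtomsR l) ((2 * j + 1) * π / b.Mc) mom := by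
  unfold latMom at h
  cases hZ : c.latPhase1 b j l with
  | none => simp [hZ] at h
  | some Z =>
    simp only [hZ, Option.some.injEq] at h
    subst h
    have hθc : MI.mem c.base.S ((2 * j + 1) * π / b.Mc) ((c.base.piI.mulInt (2 * j + 1)).divNat b.Mc) := by
      have := MI.mem_divNat (MI.mem_mulInt hpi (2 * j + 1)) (n := b.Mc) (by omega)
      convert this using 1; push_cast; ring
    have harg := MI.mem_mul hS hr hθc
    unfold latPhase1 at hZ
    have hE := MC.mem_expI hS hpi hZ harg
    have h0 : MC.mem c.base.S (Complex.exp (↑(c.ratR l * ((2 * j + 1) * π / b.Mc)) * I) ^ 0) (MC.ofInt c.base.S 1) := by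
      simpa using MC.mem_ofInt c.base.S 1
    unfold latAtomsR
    exact momMem_scaleMom hS (latMomAux_mem hS hr hE l.atoms 0 _ h0) (DKCert.powList_spec hS hr (2 * c.base.R + 1)).2

/-- `latsMom` encloses the moments of the atoms of a list of lattices. [folklore] -/
theorem latsMom_mem (hS : 0 < c.base.S) (hpi : MI.mem c.base.S Real.pi c.base.piI) {b : DKBlock} (hMc : 1 ≤ b.Mc)
    (j : ℤ) : ∀ (ls : List DKLat), (∀ l ∈ ls, MI.mem c.base.S (c.ratR l) l.rI) →
      ∀ {mom : List MI}, c.latsMom b j ls = some mom → DKCert.MomMem c.base (c.latJoinR ls) ((2 * j + 1) * π / b.Mc) mom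
  | [], _, mom, h => by
      simp only [latsMom, Option.some.injEq] at h
      subst h
      simpa [latJoinR] using DKCert.momMem_zero (c := c.base) _
  | l :: ls, hr, mom, h => by
      simp only [latsMom] at h
      cases h1 : c.latMom b j l with
      | none => simp [h1] at h
      | some m =>
        cases h2 : c.latsMom b j ls with
        | none => simp [h1, h2] at h
        | some ms =>
          simp only [h1, h2, Option.some.injEq] at h
          subst h
          simp only [latJoinR]
          exact momMem_addMom (latMom_mem hS hpi hMc (hr l (by simp)) j h1)
            (latsMom_mem hS hpi hMc j ls (fun l' hl' ↦ hr l' (by simp [hl'])) h2)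

/-- `ncList` of a concatenation of represented lists. [folklore] -/
theorem ncList_append : ∀ {xs : List DKCert.GTerm} {rxs : List RTerm},
    List.Forall₂ (DKCert.GRepr c.base.S c.base.R) xs rxs → ∀ (ys : List DKCert.GTerm) (rys : List RTerm),
      DKCert.ncList (xs ++ ys) (rxs ++ rys) = DKCert.ncList xs rxs ++ DKCert.ncList ys rys
  | _, _, List.Forall₂.nil, ys, rys => by simp [DKCert.ncList]
  | _, _, @List.Forall₂.cons _ _ _ t rt xs rxs _ hF, ys, rys => by
      have ih := ncList_append hF ys rys
      by_cases h : t.comm = true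
      · simp [DKCert.ncList, h, ih]
      · simp [DKCert.ncList, h, ih]

/-- The lattice atoms are all NON-periodic terms: `ncList (latJoin) (latJoinR) = latJoinR`. [folklore] -/
theorem ncList_latJoin : ∀ (ls : List DKLat), DKCert.ncList (c.latJoin ls) (c.latJoinR ls) = c.latJoinR ls
  | [] => by simp [latJoin, latJoinR, DKCert.ncList]
  | l :: ls => by
      simp only [latJoin, latJoinR]
      have hat : ∀ (as : List DKAtom) (ys : List DKCert.GTerm) (rys : List RTerm),
          DKCert.ncList (as.map (c.latAtomTerm l) ++ ys) (as.map (c.latAtomR l) ++ rys) =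
            as.map (c.latAtomR l) ++ DKCert.ncList ys rys := by
        intro as ys rys
        induction as with
        | nil => simp
        | cons atm as ih =>
            simp only [List.map_cons, List.cons_append, DKCert.ncList]
            have : (c.latAtomTerm l atm).comm = false := rfl
            simp [this, ih]
      unfold latAtomTerms latAtomsR
      rw [hat, ncList_latJoin ls]

/-- **The fast moment accumulators enclose the real moments of `terms3R`** (all terms, and the non-periodic
ones), at `θc = (2j+1)π/Mc`. [folklore] -/
theorem momentsP_mem (hS : 0 < c.base.S) (hpi : MI.mem c.base.S Real.pi c.base.piI) {b : DKBlock}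
    (htab : c.base.tabOK b = true) (hMc : 1 ≤ b.Mc)
    (hFb : List.Forall₂ (DKCert.GRepr c.base.S c.base.R) c.base.terms c.base.termsR)
    (hr : ∀ l ∈ c.lats, MI.mem c.base.S (c.ratR l) l.rI) (j : ℤ) {acc : List MI × List MI}
    (h : c.momentsP b j = some acc) :
    DKCert.MomMem c.base c.terms3R ((2 * j + 1) * π / b.Mc) acc.1 ∧
      DKCert.MomMem c.base (DKCert.ncList c.terms3 c.terms3R) ((2 * j + 1) * π / b.Mc) acc.2 := by
  unfold momentsP at h
  cases h1 : c.momentsB b j c.base.terms with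
  | none => simp [h1] at h
  | some acc0 =>
    cases h2 : c.latsMom b j c.lats with
    | none => simp [h1, h2] at h
    | some lm =>
      simp only [h1, h2, Option.some.injEq] at h
      subst h
      obtain ⟨⟨_, hA⟩, ⟨_, hN⟩⟩ := momentsB_mem hS hpi htab hMc j hFb h1
      have hL := latsMom_mem hS hpi hMc j c.lats hr h2
      refine ⟨?_, ?_⟩
      · unfold terms3R; exact momMem_addMom hA hL
      · unfold terms3 terms3R
        rw [ncList_append hFb, ncList_latJoin]
        exact momMem_addMom hN hL

end DKCert3

end Summit.Ventures.WeilGRH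

end
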